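import Mathlib.Analysis.SpecialFunctions.Pow.Asymptotics
import Literature.Analysis.FluidPDE.PressureHarmonicPart
import Literature.Analysis.FluidPDE.NecasRuzickaSverakRiesz
import HarnessLib

/-!
# Pressure normalisation for classical solutions with `L^q` slices (Tao's Lemma 4.1 (i) in `L^q`)

Analysis/FluidPDE proofs file (theorems only), second half of the `L^q` version of Tao's
pressure-normalisation lemma (T. Tao, Anal. PDE 6 (2013) = arXiv:1108.1165, Lemma 4.1 (i):
"`p = −Δ⁻¹∂ᵢ∂ⱼ(uᵢuⱼ) + C(t)`"), on the discharge path of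
`Literature.Analysis.FluidPDE.chaeWolf2017_dss_typeI_decay` (Chae–Wolf 2017, Thm. 1.1: classical
solutions with slices in `C((−∞,0); L^q)`, `3 ≤ q < ∞`). The `L³` case is the accepted
`PressureNormalisationL3.lean`; here the slice pressure is any `Q(t) ∈ L^{q/2}` solving the weak
pressure Poisson equation of `u(t)` (for instance the Calderón–Zygmund pressure of
`exists_rieszPressure`, `NecasRuzickaSverakRiesz.lean`), `2 < q`.

**Main results.**

* `fderiv_mollified_harmonicPart_eq_zero`, `mollified_harmonicPart_eq_const`,
  `pressure_ae_eq_add_const` — for a classical solution of the unforced system (`ν ≥ 0`) on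
  `(t₁, t₂)` with `sup_t ‖u(t)‖_{L^q} ≤ M` and slice pressures `Q(t)` with
  `sup_t ‖Q(t)‖_{L^{q/2}} ≤ P`: every mollification of `p(t) − Q(t)` has zero gradient, hence
  `p(t) = Q(t) + C(t)` a.e., for every `t`;
* `exists_pressure_ae_eq_rieszPressure_add_const` — combined with `exists_rieszPressure`: for
  every `t` there is `Q ∈ L^{q/2}` with `‖Q‖_{q/2} ≤ C_q ‖u(t)‖²_q`, `∫ Q Δφ = −∫ D²φ(u(t), u(t))`
  and `p(t) = Q + C(t)` a.e. — the Calderón–Zygmund normalisation "(2.4b)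
  `‖π(t)‖_{p/2} ≤ C ‖u(t)‖²_p`" of Chae–Wolf 2017 (arXiv p. 5) for their a priori arbitrary
  smooth pressure.

**Proof** (Tao's, as in the `L³` file, with Hölder on balls in `L^q × L^{q/2}`). With
`g(t) = p(t) − Q(t)` and a normed bump `θ` of radius `≤ 1`, `θ ⋆ g(t)` is harmonic and
`∂ₐ(θ ⋆ g(t))(x₀) = νA + B − W' − D` (probe identity of `PressureHarmonicPart.lean`) for every
probe scale `R ≥ 1`, where on the ball `B(x₀, 2R+1)` (volume `≤ 27|B₁|R³`)
`∫_B ‖u‖ ≤ |B|^{1−1/q} M`, `∫_B ‖u‖² ≤ |B|^{1−2/q} M²`, `∫_B |Q| ≤ |B|^{1−2/q} P`, so that with the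
kernel sizes `|Φ| ≤ (mR³)⁻¹`, `‖DΦ‖ ≲ (mR³)⁻¹R⁻¹`, `|ΔΦ| ≲ (mR³)⁻¹R⁻²` each of `A`, `B`, `D` and
the boundary term `W = ∫⟪u(t), Ψ⟫` is `O(R^{-3/q})` uniformly in `t`. The real-variable uniqueness
lemma `eq_zero_of_approx_antiderivative` gives `∇(θ ⋆ g(t)) = 0`, and `g(t)` is a.e. constant by
`ConvolutionLaplacian.ae_eq_const_of_forall_convolution_normed_const`.

## References

* T. Tao, *Localisation and compactness properties of the Navier–Stokes global regularity
  problem*, Anal. PDE 6 (2013) 25–107 = arXiv:1108.1165, §4, Lemma 4.1 (i) and its proof.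
  [Tao2011]
* D. Chae, J. Wolf, Comm. PDE 42 (2017) = arXiv:1610.09464, §2, (2.4b) (arXiv p. 5).
  [ChaeWolf2017RemovingDSS]
* J. Nečas, M. Růžička, V. Šverák, Acta Math. 176 (1996), §2 (the Riesz pressure in `L^q`).
  [NecasRuzickaSverak1996]
-/

noncomputable section

open MeasureTheory Set Filter Metric Function ContinuousLinearMap
open scoped Topology Laplacian ContDiff Convolution InnerProductSpace RealInnerProductSpace ENNReal
  NNReal

namespace Literature.Analysis.FluidPDE

namespace PressureNormalisation

open PressureNormalisationL3

/-! ### Hölder on balls -/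

/-- **Hölder on a ball**: `∫_B ‖f‖ ≤ |B|^{1 − 1/r} ‖f‖_{L^r}` for `1 ≤ r < ∞` and
`‖f‖_{L^r} ≤ M`. [folklore] -/
theorem setIntegral_norm_le_of_eLpNorm_le {F' : Type*} [NormedAddCommGroup F']
    {f : (EuclideanSpace ℝ (Fin 3)) → F'} (hf : AEStronglyMeasurable f volume) {r : ℝ≥0∞}
    (hr : 1 ≤ r) (hrtop : r ≠ ⊤) {M : ℝ≥0} (hM : eLpNorm f r volume ≤ M)
    (x₀ : (EuclideanSpace ℝ (Fin 3))) (ρ : ℝ) :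
    ∫ y in closedBall x₀ ρ, ‖f y‖ ≤
      ((volume : Measure (EuclideanSpace ℝ (Fin 3))).real (closedBall x₀ ρ)) ^ (1 - r.toReal⁻¹) *
        (M : ℝ) := by
  set B := closedBall x₀ ρ with hB
  have hBfin : volume B < ⊤ := measure_closedBall_lt_top
  have hm : AEStronglyMeasurable f (volume.restrict B) := hf.restrict
  have hexp : 0 ≤ 1 - r.toReal⁻¹ := by
    have h1 : 1 ≤ r.toReal := by
      have := ENNReal.toReal_mono hrtop hr
      rwa [ENNReal.toReal_one] at this
    have := inv_le_one_of_one_le₀ h1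
    linarith
  have h1 : eLpNorm f 1 (volume.restrict B) ≤
      eLpNorm f r (volume.restrict B) * (volume.restrict B) univ ^ (1 - r.toReal⁻¹) := by
    have h := eLpNorm_le_eLpNorm_mul_rpow_measure_univ (p := 1) (q := r) hr hm
    have he : 1 / (1 : ℝ≥0∞).toReal - 1 / r.toReal = 1 - r.toReal⁻¹ := by
      rw [ENNReal.toReal_one]; ring
    rwa [he] at h
  rw [Measure.restrict_apply_univ] at h1
  have h2 : eLpNorm f 1 (volume.restrict B) ≤ (M : ℝ≥0∞) * volume B ^ (1 - r.toReal⁻¹) :=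
    h1.trans (mul_le_mul' ((eLpNorm_restrict_le _ _ _ _).trans hM) le_rfl)
  have hne : (M : ℝ≥0∞) * volume B ^ (1 - r.toReal⁻¹) ≠ ⊤ :=
    ENNReal.mul_ne_top ENNReal.coe_ne_top (ENNReal.rpow_ne_top_of_nonneg hexp hBfin.ne)
  have h3 := ENNReal.toReal_mono hne h2
  rw [eLpNorm_one_eq_lintegral_enorm, ENNReal.toReal_mul, ← ENNReal.toReal_rpow,
    ENNReal.coe_toReal] at h3
  rw [integral_norm_eq_lintegral_enorm hm, measureReal_def, mul_comm]
  exact h3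

/-- `‖ ‖v‖² ‖_{L^{q/2}} ≤ M²` when `‖v‖_{L^q} ≤ M` (`q > 0`). [folklore] -/
theorem eLpNorm_norm_sq_le {F' : Type*} [NormedAddCommGroup F']
    {v : (EuclideanSpace ℝ (Fin 3)) → F'} {q : ℝ} (hq : 0 < q) {M : ℝ≥0}
    (hM : eLpNorm v (ENNReal.ofReal q) volume ≤ M) :
    eLpNorm (fun y => ‖v y‖ ^ 2) (ENNReal.ofReal (q / 2)) volume ≤ ((M ^ 2 : ℝ≥0) : ℝ≥0∞) := by
  have e : eLpNorm (fun y => ‖v y‖ ^ (2 : ℝ)) (ENNReal.ofReal (q / 2)) volume =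
      eLpNorm v (ENNReal.ofReal (q / 2) * ENNReal.ofReal 2) volume ^ (2 : ℝ) :=
    eLpNorm_norm_rpow v two_pos
  have e2 : ENNReal.ofReal (q / 2) * ENNReal.ofReal 2 = ENNReal.ofReal q := by
    rw [← ENNReal.ofReal_mul (by linarith)]
    congr 1; ring
  have e3 : (fun y => ‖v y‖ ^ (2 : ℝ)) = fun y => ‖v y‖ ^ 2 := by
    funext y; exact Real.rpow_two _
  rw [e2, e3] at e
  rw [e, ENNReal.coe_pow]
  have : eLpNorm v (ENNReal.ofReal q) volume ^ (2 : ℝ) = eLpNorm v (ENNReal.ofReal q) volume ^ 2 := by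
    exact_mod_cast ENNReal.rpow_natCast _ 2
  rw [this]
  gcongr

/-! ### Scale bookkeeping -/

/-- The ball `B̄(x₀, 2R+1)` has volume `≤ 27 |B̄(0,1)| R³` for `R ≥ 1`. [folklore] -/
private theorem volume_real_closedBall_le {R : ℝ} (hR : 1 ≤ R) (x₀ : (EuclideanSpace ℝ (Fin 3))) :
    (volume : Measure (EuclideanSpace ℝ (Fin 3))).real (closedBall x₀ (2 * R + 1)) ≤
      27 * (volume : Measure (EuclideanSpace ℝ (Fin 3))).real
        (closedBall (0 : (EuclideanSpace ℝ (Fin 3))) 1) * R ^ 3 := by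
  rw [Measure.addHaar_real_closedBall' volume x₀ (by linarith), finrank_euclideanSpace_fin]
  have h : (2 * R + 1) ^ 3 ≤ 27 * R ^ 3 := by
    nlinarith [pow_le_pow_left₀ (by linarith : (0:ℝ) ≤ 2 * R + 1) (by linarith : 2 * R + 1 ≤ 3 * R) 3]
  calc (2 * R + 1) ^ 3 * (volume : Measure (EuclideanSpace ℝ (Fin 3))).real (closedBall 0 1)
      ≤ 27 * R ^ 3 * (volume : Measure (EuclideanSpace ℝ (Fin 3))).real (closedBall 0 1) :=
        mul_le_mul_of_nonneg_right h measureReal_nonneg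
    _ = _ := by ring

/-- Powers of the volume of `B̄(x₀, 2R+1)`: `|B|^γ ≤ (27|B₁|)^γ (R³)^γ` (`γ ≥ 0`, `R ≥ 1`). [folklore] -/
private theorem measureReal_closedBall_rpow_le {R : ℝ} (hR : 1 ≤ R) (x₀ : (EuclideanSpace ℝ (Fin 3)))
    {γ : ℝ} (hγ : 0 ≤ γ) :
    ((volume : Measure (EuclideanSpace ℝ (Fin 3))).real (closedBall x₀ (2 * R + 1))) ^ γ ≤
      (27 * (volume : Measure (EuclideanSpace ℝ (Fin 3))).real
        (closedBall (0 : (EuclideanSpace ℝ (Fin 3))) 1)) ^ γ * (R ^ 3) ^ γ := by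
  have hR0 : 0 ≤ R := by linarith
  rw [← Real.mul_rpow (by positivity) (by positivity)]
  exact Real.rpow_le_rpow measureReal_nonneg (volume_real_closedBall_le hR x₀) hγ

/-- Scale bookkeeping: `(R³)⁻¹ (R⁻¹)ᵏ (R³)^γ ≤ R^{3γ−3}` for `R ≥ 1`. [folklore] -/
private theorem scale_le {R : ℝ} (hR : 1 ≤ R) (γ : ℝ) (k : ℕ) :
    (R ^ 3)⁻¹ * R⁻¹ ^ k * (R ^ 3) ^ γ ≤ R ^ (3 * γ - 3) := by
  have hR0 : 0 < R := by linarith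
  have h1 : R⁻¹ ^ k ≤ 1 := pow_le_one₀ (by positivity) (inv_le_one_of_one_le₀ hR)
  have e : R ^ (3 * γ - 3) = (R ^ 3)⁻¹ * (R ^ 3) ^ γ := by
    rw [Real.rpow_sub hR0, show (3 : ℝ) * γ = ((3 : ℕ) : ℝ) * γ by norm_num,
      Real.rpow_natCast_mul hR0.le, show (3 : ℝ) = ((3 : ℕ) : ℝ) by norm_num, Real.rpow_natCast]
    ring
  rw [e]
  calc (R ^ 3)⁻¹ * R⁻¹ ^ k * (R ^ 3) ^ γ ≤ (R ^ 3)⁻¹ * 1 * (R ^ 3) ^ γ := by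
        gcongr
    _ = (R ^ 3)⁻¹ * (R ^ 3) ^ γ := by rw [mul_one]

/-- Monotonicity of the rate: `R^{−6/q} ≤ R^{−3/q}` and `R^{−3/q} ≤ 1`-type facts, in the form
`R^{3(1 − 2/q) − 3} ≤ R^{−(3/q)}` for `R ≥ 1`, `q > 0`. [folklore] -/
private theorem rpow_rate_le {R q : ℝ} (hR : 1 ≤ R) (hq : 0 < q) :
    R ^ (3 * (1 - 2 / q) - 3) ≤ R ^ (-(3 / q)) := by
  refine Real.rpow_le_rpow_of_exponent_le hR ?_
  have : 0 ≤ 3 / q := by positivity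
  linarith [show 3 * (1 - 2 / q) - 3 = -(6 / q) by ring, show (6 : ℝ) / q = 2 * (3 / q) by ring]

/-! ### The four probe terms are `O(R^{-3/q})` -/

section Bounds

variable (φ : ContDiffBump (0 : (EuclideanSpace ℝ (Fin 3))))

/-- **The boundary term** `W = ∫ ⟪v, Φ(x₀ − ·) a⟫` is `O(R^{-3/q})`: `|W| ≤ K M R^{-3/q}` whenever
`‖v‖_{L^q} ≤ M`, `1 ≤ q`, `R ≥ 1` (`|Φ| ≤ (mR³)⁻¹` on a ball of volume `≤ 27|B₁|R³`, Hölder). [folklore] -/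
theorem exists_bound_boundary (hφ : φ.rOut ≤ 1) {q : ℝ} (hq : 1 ≤ q) (a : (EuclideanSpace ℝ (Fin 3))) :
    ∃ K, 0 ≤ K ∧ ∀ (v : (EuclideanSpace ℝ (Fin 3)) → (EuclideanSpace ℝ (Fin 3))) (M : ℝ≥0),
      Continuous v → eLpNorm v (ENNReal.ofReal q) volume ≤ M → ∀ R : ℝ, 1 ≤ R →
      ∀ x₀ : (EuclideanSpace ℝ (Fin 3)),
      (Integrable fun y => ⟪v y, (probeBump R ⋆ φ.normed volume) (x₀ - y) • a⟫) ∧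
      |∫ y, ⟪v y, (probeBump R ⋆ φ.normed volume) (x₀ - y) • a⟫| ≤ K * M * R ^ (-(3 / q)) := by
  set m := baseBumpMass (EuclideanSpace ℝ (Fin 3)) with hm_def
  have hm : 0 < m := baseBumpMass_pos
  set V₁ := (volume : Measure (EuclideanSpace ℝ (Fin 3))).real (closedBall (0 : (EuclideanSpace ℝ (Fin 3))) 1) with hV₁
  have hV₁0 : 0 ≤ V₁ := measureReal_nonneg
  have hq0 : 0 < q := one_pos.trans_le hq
  set γ : ℝ := 1 - q⁻¹ with hγ
  have hγ0 : 0 ≤ γ := by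
    have := inv_le_one_of_one_le₀ hq; rw [hγ]; linarith
  refine ⟨‖a‖ * m⁻¹ * (27 * V₁) ^ γ, by positivity, ?_⟩
  intro v M hvc hvM R hR1 x₀
  have hR : 0 < R := one_pos.trans_le hR1
  set Φ := probeBump R ⋆ φ.normed volume with hΦ
  have hΦc : Continuous Φ := (contDiff_probeConv φ hR (n := 0)).continuous
  -- kernel bound and support
  have hκ : 0 ≤ ‖a‖ * (m * R ^ 3)⁻¹ := by positivity
  have hF : ∀ y, ‖⟪v y, Φ (x₀ - y) • a⟫‖ ≤ ‖a‖ * (m * R ^ 3)⁻¹ * ‖v y‖ := fun y => by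
    rw [Real.norm_eq_abs, inner_smul_right, abs_mul]
    calc |Φ (x₀ - y)| * |⟪v y, a⟫| ≤ (m * R ^ 3)⁻¹ * (‖v y‖ * ‖a‖) :=
          mul_le_mul (abs_probeConv_le φ hR _) (abs_real_inner_le_norm _ _) (abs_nonneg _)
            (by positivity)
      _ = ‖a‖ * (m * R ^ 3)⁻¹ * ‖v y‖ := by ring
  have hF0 : ∀ y, 2 * R + 1 < dist y x₀ → ⟪v y, Φ (x₀ - y) • a⟫ = 0 := fun y hy => by
    rw [hΦ, probeConv_comp_sub_eq_zero φ hφ hR x₀ hy, zero_smul, inner_zero_right]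
  have hFm : AEStronglyMeasurable (fun y => ⟪v y, Φ (x₀ - y) • a⟫) volume :=
    (hvc.inner ((hΦc.comp (continuous_const.sub continuous_id)).smul continuous_const)).aestronglyMeasurable
  obtain ⟨hint, hI⟩ := norm_integral_le_of_kernel_bound
    (hvc.norm.continuousOn.integrableOn_compact (isCompact_closedBall x₀ (2 * R + 1))) hFm hF hF0
  refine ⟨hint, ?_⟩
  rw [← Real.norm_eq_abs]
  refine hI.trans ?_
  -- Hölder on the ball
  have hq1 : (1 : ℝ≥0∞) ≤ ENNReal.ofReal q := by
    rw [← ENNReal.ofReal_one]; exact ENNReal.ofReal_le_ofReal hq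
  have hB := setIntegral_norm_le_of_eLpNorm_le hvc.aestronglyMeasurable hq1 ENNReal.ofReal_ne_top
    hvM x₀ (2 * R + 1)
  rw [ENNReal.toReal_ofReal hq0.le] at hB
  have hvol := measureReal_closedBall_rpow_le hR1 x₀ hγ0
  have hsc := scale_le hR1 γ 0
  simp only [pow_zero, mul_one] at hsc
  have hexp : (3 : ℝ) * γ - 3 = -(3 / q) := by rw [hγ]; ring
  rw [hexp] at hsc
  calc ‖a‖ * (m * R ^ 3)⁻¹ * ∫ y in closedBall x₀ (2 * R + 1), ‖v y‖
      ≤ ‖a‖ * (m * R ^ 3)⁻¹ * (((27 * V₁) ^ γ * (R ^ 3) ^ γ) * M) := by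
        refine mul_le_mul_of_nonneg_left (hB.trans ?_) hκ
        exact mul_le_mul_of_nonneg_right hvol M.coe_nonneg
    _ = ‖a‖ * m⁻¹ * (27 * V₁) ^ γ * M * ((R ^ 3)⁻¹ * (R ^ 3) ^ γ) := by
        field_simp
    _ ≤ ‖a‖ * m⁻¹ * (27 * V₁) ^ γ * M * R ^ (-(3 / q)) :=
        mul_le_mul_of_nonneg_left hsc (by positivity)

/-- **The viscous term** `A = ∫ ⟪v, Δ(Φ(x₀ − ·)) a⟫` is `O(R^{-3/q})` (`|ΔΦ| ≤ C₂(mR³)⁻¹R⁻²`,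
Hölder on the ball). [folklore] -/
theorem exists_bound_laplacian (hφ : φ.rOut ≤ 1) {q : ℝ} (hq : 1 ≤ q) (a : (EuclideanSpace ℝ (Fin 3))) :
    ∃ K, 0 ≤ K ∧ ∀ (v : (EuclideanSpace ℝ (Fin 3)) → (EuclideanSpace ℝ (Fin 3))) (M : ℝ≥0),
      Continuous v → eLpNorm v (ENNReal.ofReal q) volume ≤ M → ∀ R : ℝ, 1 ≤ R →
      ∀ x₀ : (EuclideanSpace ℝ (Fin 3)),
      |∫ y, ⟪v y, (Δ (fun y => (probeBump R ⋆ φ.normed volume) (x₀ - y))) y • a⟫| ≤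
        K * M * R ^ (-(3 / q)) := by
  obtain ⟨⟨C₁, hC₁⟩, ⟨C₂, hC₂⟩⟩ := exists_bound_baseBump_derivs (E := (EuclideanSpace ℝ (Fin 3)))
  have hC₂0 : 0 ≤ C₂ := (abs_nonneg _).trans (hC₂ 0)
  set m := baseBumpMass (EuclideanSpace ℝ (Fin 3)) with hm_def
  have hm : 0 < m := baseBumpMass_pos
  set V₁ := (volume : Measure (EuclideanSpace ℝ (Fin 3))).real (closedBall (0 : (EuclideanSpace ℝ (Fin 3))) 1) with hV₁
  have hV₁0 : 0 ≤ V₁ := measureReal_nonneg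
  have hq0 : 0 < q := one_pos.trans_le hq
  set γ : ℝ := 1 - q⁻¹ with hγ
  have hγ0 : 0 ≤ γ := by
    have := inv_le_one_of_one_le₀ hq; rw [hγ]; linarith
  refine ⟨‖a‖ * m⁻¹ * C₂ * (27 * V₁) ^ γ, by positivity, ?_⟩
  intro v M hvc hvM R hR1 x₀
  have hR : 0 < R := one_pos.trans_le hR1
  set Φ := probeBump R ⋆ φ.normed volume with hΦ
  have hΦ2 : ContDiff ℝ 2 Φ := contDiff_probeConv φ hR
  set L : (EuclideanSpace ℝ (Fin 3)) → ℝ := Δ (fun y => Φ (x₀ - y)) with hL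
  have hL' : ∀ y, L y = (Δ Φ) (x₀ - y) := fun y => laplacian_comp_const_sub Φ x₀ y
  have hLc : Continuous L := by
    have : L = fun y => (Δ Φ) (x₀ - y) := funext hL'
    rw [this]
    exact (FluidPDE.continuous_laplacian hΦ2).comp (continuous_const.sub continuous_id)
  have hκ : 0 ≤ ‖a‖ * ((m * R ^ 3)⁻¹ * R⁻¹ ^ 2 * C₂) := by positivity
  have hF : ∀ y, ‖⟪v y, L y • a⟫‖ ≤ ‖a‖ * ((m * R ^ 3)⁻¹ * R⁻¹ ^ 2 * C₂) * ‖v y‖ := fun y => by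
    rw [Real.norm_eq_abs, inner_smul_right, abs_mul, hL' y]
    calc |(Δ Φ) (x₀ - y)| * |⟪v y, a⟫| ≤ ((m * R ^ 3)⁻¹ * R⁻¹ ^ 2 * C₂) * (‖v y‖ * ‖a‖) :=
          mul_le_mul (abs_laplacian_probeConv_le φ hR hC₂ _) (abs_real_inner_le_norm _ _)
            (abs_nonneg _) (by positivity)
      _ = ‖a‖ * ((m * R ^ 3)⁻¹ * R⁻¹ ^ 2 * C₂) * ‖v y‖ := by ring
  have hF0 : ∀ y, 2 * R + 1 < dist y x₀ → ⟪v y, L y • a⟫ = 0 := fun y hy => by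
    rw [hL' y, laplacian_probeConv_eq_zero φ hR, zero_smul, inner_zero_right]
    rw [← norm_neg, neg_sub, ← dist_eq_norm]
    linarith
  have hFm : AEStronglyMeasurable (fun y => ⟪v y, L y • a⟫) volume :=
    (hvc.inner (hLc.smul continuous_const)).aestronglyMeasurable
  obtain ⟨-, hI⟩ := norm_integral_le_of_kernel_bound
    (hvc.norm.continuousOn.integrableOn_compact (isCompact_closedBall x₀ (2 * R + 1))) hFm hF hF0
  rw [← Real.norm_eq_abs]
  refine hI.trans ?_
  have hq1 : (1 : ℝ≥0∞) ≤ ENNReal.ofReal q := by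
    rw [← ENNReal.ofReal_one]; exact ENNReal.ofReal_le_ofReal hq
  have hB := setIntegral_norm_le_of_eLpNorm_le hvc.aestronglyMeasurable hq1 ENNReal.ofReal_ne_top
    hvM x₀ (2 * R + 1)
  rw [ENNReal.toReal_ofReal hq0.le] at hB
  have hvol := measureReal_closedBall_rpow_le hR1 x₀ hγ0
  have hsc := scale_le hR1 γ 2
  have hexp : (3 : ℝ) * γ - 3 = -(3 / q) := by rw [hγ]; ring
  rw [hexp] at hsc
  calc ‖a‖ * ((m * R ^ 3)⁻¹ * R⁻¹ ^ 2 * C₂) * ∫ y in closedBall x₀ (2 * R + 1), ‖v y‖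
      ≤ ‖a‖ * ((m * R ^ 3)⁻¹ * R⁻¹ ^ 2 * C₂) * (((27 * V₁) ^ γ * (R ^ 3) ^ γ) * M) := by
        refine mul_le_mul_of_nonneg_left (hB.trans ?_) hκ
        exact mul_le_mul_of_nonneg_right hvol M.coe_nonneg
    _ = ‖a‖ * m⁻¹ * C₂ * (27 * V₁) ^ γ * M * ((R ^ 3)⁻¹ * R⁻¹ ^ 2 * (R ^ 3) ^ γ) := by
        field_simp
    _ ≤ ‖a‖ * m⁻¹ * C₂ * (27 * V₁) ^ γ * M * R ^ (-(3 / q)) :=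
        mul_le_mul_of_nonneg_left hsc (by positivity)

/-- **The transport term** `B = ∫ ⟪v, (v·∇)(Φ(x₀ − ·)) a⟫` is `O(R^{-3/q})`
(`‖DΦ‖ ≤ C₁(mR³)⁻¹R⁻¹` against `∫_B ‖v‖² ≤ |B|^{1−2/q} M²`, `q ≥ 2`). [folklore] -/
theorem exists_bound_transport (hφ : φ.rOut ≤ 1) {q : ℝ} (hq : 2 ≤ q) (a : (EuclideanSpace ℝ (Fin 3))) :
    ∃ K, 0 ≤ K ∧ ∀ (v : (EuclideanSpace ℝ (Fin 3)) → (EuclideanSpace ℝ (Fin 3))) (M : ℝ≥0),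
      Continuous v → eLpNorm v (ENNReal.ofReal q) volume ≤ M → ∀ R : ℝ, 1 ≤ R →
      ∀ x₀ : (EuclideanSpace ℝ (Fin 3)),
      |∫ y, ⟪v y, fderiv ℝ (fun y => (probeBump R ⋆ φ.normed volume) (x₀ - y)) y (v y) • a⟫| ≤
        K * M ^ 2 * R ^ (-(3 / q)) := by
  obtain ⟨⟨C₁, hC₁⟩, ⟨C₂, hC₂⟩⟩ := exists_bound_baseBump_derivs (E := (EuclideanSpace ℝ (Fin 3)))
  have hC₁0 : 0 ≤ C₁ := (norm_nonneg _).trans (hC₁ 0)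
  set m := baseBumpMass (EuclideanSpace ℝ (Fin 3)) with hm_def
  have hm : 0 < m := baseBumpMass_pos
  set V₁ := (volume : Measure (EuclideanSpace ℝ (Fin 3))).real (closedBall (0 : (EuclideanSpace ℝ (Fin 3))) 1) with hV₁
  have hV₁0 : 0 ≤ V₁ := measureReal_nonneg
  have hq0 : 0 < q := by linarith
  set γ : ℝ := 1 - 2 / q with hγ
  have hγ0 : 0 ≤ γ := by
    have : 2 / q ≤ 1 := by rw [div_le_one hq0]; exact hq
    rw [hγ]; linarith
  refine ⟨‖a‖ * m⁻¹ * C₁ * (27 * V₁) ^ γ, by positivity, ?_⟩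
  intro v M hvc hvM R hR1 x₀
  have hR : 0 < R := one_pos.trans_le hR1
  set Φ := probeBump R ⋆ φ.normed volume with hΦ
  have hΦ1 : ContDiff ℝ 1 Φ := contDiff_probeConv φ hR
  have hD : ∀ y, fderiv ℝ (fun y => Φ (x₀ - y)) y = -fderiv ℝ Φ (x₀ - y) := fun y =>
    fderiv_comp_const_sub Φ x₀ y
  have hκ : 0 ≤ ‖a‖ * ((m * R ^ 3)⁻¹ * R⁻¹ * C₁) := by positivity
  have hF : ∀ y, ‖⟪v y, fderiv ℝ (fun y => Φ (x₀ - y)) y (v y) • a⟫‖ ≤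
      ‖a‖ * ((m * R ^ 3)⁻¹ * R⁻¹ * C₁) * ‖v y‖ ^ 2 := fun y => by
    rw [Real.norm_eq_abs, inner_smul_right, abs_mul, hD y]
    calc |(-fderiv ℝ Φ (x₀ - y)) (v y)| * |⟪v y, a⟫|
        ≤ (‖fderiv ℝ Φ (x₀ - y)‖ * ‖v y‖) * (‖v y‖ * ‖a‖) := by
          refine mul_le_mul ?_ (abs_real_inner_le_norm _ _) (abs_nonneg _) (by positivity)
          rw [_root_.neg_apply, abs_neg, ← Real.norm_eq_abs]
          exact ContinuousLinearMap.le_opNorm _ _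
      _ ≤ (((m * R ^ 3)⁻¹ * R⁻¹ * C₁) * ‖v y‖) * (‖v y‖ * ‖a‖) := by
          gcongr
          exact norm_fderiv_probeConv_le φ hR hC₁ _
      _ = ‖a‖ * ((m * R ^ 3)⁻¹ * R⁻¹ * C₁) * ‖v y‖ ^ 2 := by ring
  have hF0 : ∀ y, 2 * R + 1 < dist y x₀ → ⟪v y, fderiv ℝ (fun y => Φ (x₀ - y)) y (v y) • a⟫ = 0 := by
    intro y hy
    have hy' : 2 * R + φ.rOut < ‖x₀ - y‖ := by
      rw [← norm_neg, neg_sub, ← dist_eq_norm]; linarith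
    have hz : fderiv ℝ Φ (x₀ - y) = 0 := by
      ext w
      rw [fderiv_probeConv_apply_eq_zero φ hR hy']
      rfl
    rw [hD y, hz, neg_zero, _root_.zero_apply, zero_smul, inner_zero_right]
  have hFm : AEStronglyMeasurable
      (fun y => ⟪v y, fderiv ℝ (fun y => Φ (x₀ - y)) y (v y) • a⟫) volume := by
    have hc : Continuous fun y => fderiv ℝ (fun y => Φ (x₀ - y)) y (v y) := by
      have e : (fun y => fderiv ℝ (fun y => Φ (x₀ - y)) y (v y)) =
          fun y => (-fderiv ℝ Φ (x₀ - y)) (v y) := funext fun y => by rw [hD y]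
      rw [e]
      exact ((hΦ1.continuous_fderiv one_ne_zero).comp (continuous_const.sub continuous_id)).neg.clm_apply
        hvc
    exact (hvc.inner (hc.smul continuous_const)).aestronglyMeasurable
  obtain ⟨-, hI⟩ := norm_integral_le_of_kernel_bound
    ((hvc.norm.pow 2).continuousOn.integrableOn_compact (isCompact_closedBall x₀ (2 * R + 1)))
    hFm hF hF0
  rw [← Real.norm_eq_abs]
  refine hI.trans ?_
  -- Hölder on the ball for `‖v‖² ∈ L^{q/2}`
  have hq1 : (1 : ℝ≥0∞) ≤ ENNReal.ofReal (q / 2) := by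
    rw [← ENNReal.ofReal_one]; exact ENNReal.ofReal_le_ofReal (by linarith)
  have hsq := eLpNorm_norm_sq_le hq0 hvM
  have hmeas : AEStronglyMeasurable (fun y => ‖v y‖ ^ 2) volume :=
    (hvc.norm.pow 2).aestronglyMeasurable
  have hB := setIntegral_norm_le_of_eLpNorm_le hmeas hq1 ENNReal.ofReal_ne_top hsq x₀ (2 * R + 1)
  rw [ENNReal.toReal_ofReal (by linarith)] at hB
  have hB' : ∫ y in closedBall x₀ (2 * R + 1), ‖v y‖ ^ 2 ≤
      ((volume : Measure (EuclideanSpace ℝ (Fin 3))).real (closedBall x₀ (2 * R + 1))) ^ γ *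
        (M : ℝ) ^ 2 := by
    have e : ∫ y in closedBall x₀ (2 * R + 1), ‖v y‖ ^ 2 =
        ∫ y in closedBall x₀ (2 * R + 1), ‖‖v y‖ ^ 2‖ :=
      integral_congr_ae (Eventually.of_forall fun y => (Real.norm_of_nonneg (sq_nonneg _)).symm)
    have hγ' : 1 - (q / 2)⁻¹ = γ := by rw [hγ, inv_div]
    rw [e, ← hγ']
    simpa using hB
  have hvol := measureReal_closedBall_rpow_le hR1 x₀ hγ0
  have hsc : (R ^ 3)⁻¹ * R⁻¹ ^ 1 * (R ^ 3) ^ γ ≤ R ^ (-(3 / q)) :=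
    (scale_le hR1 γ 1).trans (by rw [hγ]; exact rpow_rate_le hR1 hq0)
  calc ‖a‖ * ((m * R ^ 3)⁻¹ * R⁻¹ * C₁) * ∫ y in closedBall x₀ (2 * R + 1), ‖v y‖ ^ 2
      ≤ ‖a‖ * ((m * R ^ 3)⁻¹ * R⁻¹ * C₁) * (((27 * V₁) ^ γ * (R ^ 3) ^ γ) * (M : ℝ) ^ 2) := by
        refine mul_le_mul_of_nonneg_left (hB'.trans ?_) hκ
        exact mul_le_mul_of_nonneg_right hvol (by positivity)
    _ = ‖a‖ * m⁻¹ * C₁ * (27 * V₁) ^ γ * (M : ℝ) ^ 2 * ((R ^ 3)⁻¹ * R⁻¹ ^ 1 * (R ^ 3) ^ γ) := by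
        field_simp
    _ ≤ ‖a‖ * m⁻¹ * C₁ * (27 * V₁) ^ γ * (M : ℝ) ^ 2 * R ^ (-(3 / q)) :=
        mul_le_mul_of_nonneg_left hsc (by positivity)

/-- **The potential term** `D = ∫ ∂ₐΦ(y) Q(x₀ − y) dy` is `O(R^{-3/q})` for `Q ∈ L^{q/2}` with
`‖Q‖_{q/2} ≤ P`, `q ≥ 2` (`|∂ₐΦ| ≤ C₁(mR³)⁻¹R⁻¹‖a‖` against `∫_B |Q| ≤ |B|^{1−2/q} P`). [folklore] -/
theorem exists_bound_potential (hφ : φ.rOut ≤ 1) {q : ℝ} (hq : 2 ≤ q) (a : (EuclideanSpace ℝ (Fin 3))) :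
    ∃ K, 0 ≤ K ∧ ∀ (Q : (EuclideanSpace ℝ (Fin 3)) → ℝ) (P : ℝ≥0),
      MemLp Q (ENNReal.ofReal (q / 2)) volume → eLpNorm Q (ENNReal.ofReal (q / 2)) volume ≤ P →
      ∀ R : ℝ, 1 ≤ R → ∀ x₀ : (EuclideanSpace ℝ (Fin 3)),
      |∫ y, fderiv ℝ (probeBump R ⋆ φ.normed volume) y a * Q (x₀ - y)| ≤ K * P * R ^ (-(3 / q)) := by
  obtain ⟨⟨C₁, hC₁⟩, ⟨C₂, hC₂⟩⟩ := exists_bound_baseBump_derivs (E := (EuclideanSpace ℝ (Fin 3)))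
  have hC₁0 : 0 ≤ C₁ := (norm_nonneg _).trans (hC₁ 0)
  set m := baseBumpMass (EuclideanSpace ℝ (Fin 3)) with hm_def
  have hm : 0 < m := baseBumpMass_pos
  set V₁ := (volume : Measure (EuclideanSpace ℝ (Fin 3))).real (closedBall (0 : (EuclideanSpace ℝ (Fin 3))) 1) with hV₁
  have hV₁0 : 0 ≤ V₁ := measureReal_nonneg
  have hq0 : 0 < q := by linarith
  set γ : ℝ := 1 - 2 / q with hγ
  have hγ0 : 0 ≤ γ := by
    have : 2 / q ≤ 1 := by rw [div_le_one hq0]; exact hq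
    rw [hγ]; linarith
  have hq1 : (1 : ℝ≥0∞) ≤ ENNReal.ofReal (q / 2) := by
    rw [← ENNReal.ofReal_one]; exact ENNReal.ofReal_le_ofReal (by linarith)
  refine ⟨‖a‖ * m⁻¹ * C₁ * (27 * V₁) ^ γ, by positivity, ?_⟩
  intro Q P hQ hP R hR1 x₀
  have hR : 0 < R := one_pos.trans_le hR1
  set Φ := probeBump R ⋆ φ.normed volume with hΦ
  have hΦ1 : ContDiff ℝ 1 Φ := contDiff_probeConv φ hR
  have hΦa : Continuous fun y => fderiv ℝ Φ y a :=
    (hΦ1.continuous_fderiv one_ne_zero).clm_apply continuous_const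
  -- move the translation onto the kernel
  rw [← integral_sub_left_eq_self (fun y => fderiv ℝ Φ y a * Q (x₀ - y)) volume x₀]
  simp only [sub_sub_cancel]
  have hκ : 0 ≤ (m * R ^ 3)⁻¹ * R⁻¹ * C₁ * ‖a‖ := by positivity
  have hF : ∀ y, ‖fderiv ℝ Φ (x₀ - y) a * Q y‖ ≤ (m * R ^ 3)⁻¹ * R⁻¹ * C₁ * ‖a‖ * ‖Q y‖ := fun y => by
    rw [norm_mul]
    exact mul_le_mul_of_nonneg_right (by rw [Real.norm_eq_abs]; exact abs_fderiv_probeConv_apply_le φ hR hC₁ _ a) (norm_nonneg _)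
  have hF0 : ∀ y, 2 * R + 1 < dist y x₀ → fderiv ℝ Φ (x₀ - y) a * Q y = 0 := fun y hy => by
    have hy' : 2 * R + φ.rOut < ‖x₀ - y‖ := by
      rw [← norm_neg, neg_sub, ← dist_eq_norm]; linarith
    rw [fderiv_probeConv_apply_eq_zero φ hR hy', zero_mul]
  have hFm : AEStronglyMeasurable (fun y => fderiv ℝ Φ (x₀ - y) a * Q y) volume :=
    ((hΦa.comp (continuous_const.sub continuous_id)).aestronglyMeasurable).mul hQ.1
  obtain ⟨-, hI⟩ := norm_integral_le_of_kernel_bound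
    (((hQ.locallyIntegrable hq1).integrableOn_isCompact
      (isCompact_closedBall x₀ (2 * R + 1))).norm) hFm hF hF0
  rw [← Real.norm_eq_abs]
  refine hI.trans ?_
  have hB := setIntegral_norm_le_of_eLpNorm_le hQ.1 hq1 ENNReal.ofReal_ne_top hP x₀ (2 * R + 1)
  rw [ENNReal.toReal_ofReal (by linarith), show 1 - (q / 2)⁻¹ = γ by rw [hγ, inv_div]] at hB
  have hvol := measureReal_closedBall_rpow_le hR1 x₀ hγ0
  have hsc : (R ^ 3)⁻¹ * R⁻¹ ^ 1 * (R ^ 3) ^ γ ≤ R ^ (-(3 / q)) :=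
    (scale_le hR1 γ 1).trans (by rw [hγ]; exact rpow_rate_le hR1 hq0)
  calc (m * R ^ 3)⁻¹ * R⁻¹ * C₁ * ‖a‖ * ∫ y in closedBall x₀ (2 * R + 1), ‖Q y‖
      ≤ (m * R ^ 3)⁻¹ * R⁻¹ * C₁ * ‖a‖ * (((27 * V₁) ^ γ * (R ^ 3) ^ γ) * P) := by
        refine mul_le_mul_of_nonneg_left (hB.trans ?_) hκ
        exact mul_le_mul_of_nonneg_right hvol P.coe_nonneg
    _ = ‖a‖ * m⁻¹ * C₁ * (27 * V₁) ^ γ * P * ((R ^ 3)⁻¹ * R⁻¹ ^ 1 * (R ^ 3) ^ γ) := by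
        field_simp
    _ ≤ ‖a‖ * m⁻¹ * C₁ * (27 * V₁) ^ γ * P * R ^ (-(3 / q)) :=
        mul_le_mul_of_nonneg_left hsc (by positivity)

end Bounds

/-! ### Assembly: `∇(θ ⋆ g(t)) = 0` and the a.e. identity -/

variable {ν : ℝ} {u : ℝ → (EuclideanSpace ℝ (Fin 3)) → (EuclideanSpace ℝ (Fin 3))}
  {p : ℝ → (EuclideanSpace ℝ (Fin 3)) → ℝ} {Qt : ℝ → (EuclideanSpace ℝ (Fin 3)) → ℝ}

/-- A choice of probe scale: for `β > 0`, `K ≥ 0` and `ε > 0` there is `R ≥ 1` with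
`K R^{−β} ≤ ε`. [folklore] -/
theorem exists_scale_rpow_le {β K ε : ℝ} (hβ : 0 < β) (hε : 0 < ε) :
    ∃ R : ℝ, 1 ≤ R ∧ K * R ^ (-β) ≤ ε := by
  have h1 : Tendsto (fun R : ℝ => K * R ^ (-β)) atTop (𝓝 (K * 0)) :=
    (tendsto_rpow_neg_atTop hβ).const_mul K
  rw [mul_zero] at h1
  have h2 : ∀ᶠ R : ℝ in atTop, K * R ^ (-β) ≤ ε := (h1.eventually (ge_mem_nhds hε))
  obtain ⟨R, hR⟩ := (h2.and (eventually_ge_atTop 1)).exists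
  exact ⟨R, hR.2, hR.1⟩

/-- **`∇(θ ⋆ (p(t) − Q(t))) = 0`** (Tao 2011, §4, conclusion of the proof of Lemma 4.1 (i), in
`L^q × L^{q/2}`, `2 < q`). For a classical solution of the unforced system on `(t₁, t₂)` with
`ν ≥ 0`, `‖u(t)‖_{L^q} ≤ M`, slice pressures `Q(t) ∈ L^{q/2}` solving the weak Poisson equation
with `‖Q(t)‖_{L^{q/2}} ≤ P`, and every normed bump `θ` of outer radius `≤ 1`: the mollified
harmonic part has vanishing derivative at every point, for every `t ∈ (t₁, t₂)` — by the probe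
identity `∂ₐ(θ ⋆ g)(t, x₀) = −W_R'(t) + O(R^{-3/q})` with `|W_R| = O(R^{-3/q})` uniformly in `t`,
and the real-variable uniqueness lemma of `HarmonicProbe`. [cite: Tao2011, §4, proof of Lemma 4.1 (i)] -/
theorem fderiv_mollified_harmonicPart_eq_zero {t₁ t₂ : ℝ} (hν : 0 ≤ ν)
    (h : IsClassicalNSSolutionOn (Ioo t₁ t₂) ν 0 u p) {q : ℝ} (hq : 2 < q) {M : ℝ≥0}
    (hM : ∀ t ∈ Ioo t₁ t₂, eLpNorm (u t) (ENNReal.ofReal q) volume ≤ M)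
    (hQ : ∀ t ∈ Ioo t₁ t₂, MemLp (Qt t) (ENNReal.ofReal (q / 2)) volume) {P : ℝ≥0}
    (hP : ∀ t ∈ Ioo t₁ t₂, eLpNorm (Qt t) (ENNReal.ofReal (q / 2)) volume ≤ P)
    (hQeq : ∀ t ∈ Ioo t₁ t₂, ∀ φ : (EuclideanSpace ℝ (Fin 3)) → ℝ, ContDiff ℝ ∞ φ →
      HasCompactSupport φ → ∫ y, Qt t y * (Δ φ) y = -∫ y, fderiv ℝ (fderiv ℝ φ) y (u t y) (u t y))
    (φ : ContDiffBump (0 : (EuclideanSpace ℝ (Fin 3)))) (hφ : φ.rOut ≤ 1)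
    (x₀ a : (EuclideanSpace ℝ (Fin 3))) :
    ∀ t ∈ Ioo t₁ t₂, fderiv ℝ (φ.normed volume ⋆ fun x => p t x - Qt t x) x₀ a = 0 := by
  have hS : IsOpen (Ioo t₁ t₂) := isOpen_Ioo
  have hq1 : (1 : ℝ) ≤ q := by linarith
  have hq2 : (2 : ℝ) ≤ q := hq.le
  have hq0 : 0 < q := by linarith
  have hβ : 0 < 3 / q := by positivity
  have hq21 : (1 : ℝ≥0∞) ≤ ENNReal.ofReal (q / 2) := by
    rw [← ENNReal.ofReal_one]; exact ENNReal.ofReal_le_ofReal (by linarith)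
  -- the constants of the four bounds
  obtain ⟨K₁, hK₁0, hK₁⟩ := exists_bound_laplacian φ hφ hq1 a
  obtain ⟨K₂, hK₂0, hK₂⟩ := exists_bound_transport φ hφ hq2 a
  obtain ⟨K₃, hK₃0, hK₃⟩ := exists_bound_boundary φ hφ hq1 a
  obtain ⟨K₄, hK₄0, hK₄⟩ := exists_bound_potential φ hφ hq2 a
  set K : ℝ := (ν * K₁ + K₃) * M + K₂ * M ^ 2 + K₄ * P with hK
  have hKnn : 0 ≤ K := by rw [hK]; positivity
  -- data along the flow
  have hdata : ∀ t ∈ Ioo t₁ t₂, Continuous (u t) := fun t ht => (h.contDiff_velocity ht).continuous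
  refine eq_zero_of_approx_antiderivative fun ε hε => ?_
  -- the scale `R ≥ 1` with `K R^{-3/q} ≤ ε`
  obtain ⟨R, hR1, hKR⟩ := exists_scale_rpow_le (K := K) hβ hε
  have hR0 : 0 < R := one_pos.trans_le hR1
  have hRβ : 0 ≤ R ^ (-(3 / q)) := Real.rpow_nonneg hR0.le _
  -- the test field `Ψ(y) = Φ(x₀ - y) a` and the boundary term
  set Φ := probeBump R ⋆ φ.normed volume with hΦdef
  have hΦs : ContDiff ℝ ∞ Φ := contDiff_probeConv φ hR0
  have hΦc : HasCompactSupport Φ := hasCompactSupport_probeConv φ hR0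
  have hΨs : ContDiff ℝ ∞ fun y : (EuclideanSpace ℝ (Fin 3)) => Φ (x₀ - y) • a :=
    (hΦs.comp (contDiff_const.sub contDiff_id)).smul contDiff_const
  have hΨc : HasCompactSupport fun y : (EuclideanSpace ℝ (Fin 3)) => Φ (x₀ - y) • a :=
    (hΦc.comp_homeomorph (Homeomorph.subLeft x₀)).smul_right (f' := fun _ => a)
  refine ⟨fun s => ∫ y, ⟪u s y, Φ (x₀ - y) • a⟫,
    fun s => ∫ y, ⟪FluidPDE.timeDerivWithin (Ioo t₁ t₂) u s y, Φ (x₀ - y) • a⟫,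
    PressureNormalisationL3.continuousOn_integral_inner_timeDerivWithin h hS hΨs.continuous hΨc,
    fun t ht => PressureNormalisationL3.hasDerivAt_integral_inner_velocity h hS hΨs hΨc ht,
    fun t ht => ?_, fun t ht => ?_⟩
  · -- `|W| ≤ ε`
    have hb := (hK₃ (u t) M (hdata t ht) (hM t ht) R hR1 x₀).2
    calc |∫ y, ⟪u t y, Φ (x₀ - y) • a⟫| ≤ K₃ * M * R ^ (-(3 / q)) := hb
      _ ≤ K * R ^ (-(3 / q)) := by
          refine mul_le_mul_of_nonneg_right ?_ hRβ
          rw [hK]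
          nlinarith [mul_nonneg hν hK₁0, mul_nonneg (mul_nonneg hν hK₁0) M.coe_nonneg,
            mul_nonneg hK₂0 (sq_nonneg (M : ℝ)), mul_nonneg hK₄0 P.coe_nonneg]
      _ ≤ ε := hKR
  · -- `|g + W'| ≤ ε`
    have huc := hdata t ht
    have b1 := hK₁ (u t) M huc (hM t ht) R hR1 x₀
    have b2 := hK₂ (u t) M huc (hM t ht) R hR1 x₀
    have b4 := hK₄ (Qt t) P (hQ t ht) (hP t ht) R hR1 x₀
    have key := fderiv_mollified_harmonicPart_eq h hS ht ((hQ t ht).locallyIntegrable hq21)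
      (hQeq t ht) φ hR0 x₀ a
    rw [key]
    dsimp only
    generalize (∫ y, ⟪u t y, (Δ (fun y => Φ (x₀ - y))) y • a⟫) = A at b1 ⊢
    generalize (∫ y, ⟪u t y, fderiv ℝ (fun y => Φ (x₀ - y)) y (u t y) • a⟫) = B at b2 ⊢
    generalize (∫ y, fderiv ℝ Φ y a * Qt t (x₀ - y)) = D at b4 ⊢
    generalize (∫ y, ⟪FluidPDE.timeDerivWithin (Ioo t₁ t₂) u t y, Φ (x₀ - y) • a⟫) = C
    have e : ν * A + B - C - D + C = ν * A + B - D := by ring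
    rw [e]
    calc |ν * A + B - D| ≤ ν * |A| + |B| + |D| := by
          calc |ν * A + B - D| ≤ |ν * A + B| + |D| := abs_sub _ _
            _ ≤ |ν * A| + |B| + |D| := by gcongr; exact abs_add_le _ _
            _ = ν * |A| + |B| + |D| := by rw [abs_mul, abs_of_nonneg hν]
      _ ≤ ν * (K₁ * M * R ^ (-(3 / q))) + K₂ * M ^ 2 * R ^ (-(3 / q)) +
            K₄ * P * R ^ (-(3 / q)) := by gcongr
      _ = ((ν * K₁) * M + K₂ * M ^ 2 + K₄ * P) * R ^ (-(3 / q)) := by ring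
      _ ≤ K * R ^ (-(3 / q)) := by
          refine mul_le_mul_of_nonneg_right ?_ hRβ
          rw [hK]
          nlinarith [mul_nonneg hK₃0 M.coe_nonneg]
      _ ≤ ε := hKR

/-- **Every mollification of the harmonic part is constant** (`θ` a normed bump of outer radius
`≤ 1`, `t ∈ (t₁, t₂)`). [cite: Tao2011, §4, proof of Lemma 4.1 (i)] -/
theorem mollified_harmonicPart_eq_const {t₁ t₂ : ℝ} (hν : 0 ≤ ν)
    (h : IsClassicalNSSolutionOn (Ioo t₁ t₂) ν 0 u p) {q : ℝ} (hq : 2 < q) {M : ℝ≥0}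
    (hM : ∀ t ∈ Ioo t₁ t₂, eLpNorm (u t) (ENNReal.ofReal q) volume ≤ M)
    (hQ : ∀ t ∈ Ioo t₁ t₂, MemLp (Qt t) (ENNReal.ofReal (q / 2)) volume) {P : ℝ≥0}
    (hP : ∀ t ∈ Ioo t₁ t₂, eLpNorm (Qt t) (ENNReal.ofReal (q / 2)) volume ≤ P)
    (hQeq : ∀ t ∈ Ioo t₁ t₂, ∀ φ : (EuclideanSpace ℝ (Fin 3)) → ℝ, ContDiff ℝ ∞ φ →
      HasCompactSupport φ → ∫ y, Qt t y * (Δ φ) y = -∫ y, fderiv ℝ (fderiv ℝ φ) y (u t y) (u t y))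
    (φ : ContDiffBump (0 : (EuclideanSpace ℝ (Fin 3)))) (hφ : φ.rOut ≤ 1) {t : ℝ} (ht : t ∈ Ioo t₁ t₂)
    (x : (EuclideanSpace ℝ (Fin 3))) :
    (φ.normed volume ⋆ fun x => p t x - Qt t x) x = (φ.normed volume ⋆ fun x => p t x - Qt t x) 0 := by
  have hq21 : (1 : ℝ≥0∞) ≤ ENNReal.ofReal (q / 2) := by
    rw [← ENNReal.ofReal_one]; exact ENNReal.ofReal_le_ofReal (by linarith)
  have hcd : ContDiff ℝ 1 (φ.normed volume ⋆ fun x => p t x - Qt t x) :=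
    (φ.hasCompactSupport_normed).contDiff_convolution_left _ φ.contDiff_normed
      (locallyIntegrable_harmonicPart h ht ((hQ t ht).locallyIntegrable hq21))
  have hdiff : Differentiable ℝ (φ.normed volume ⋆ fun x => p t x - Qt t x) :=
    hcd.differentiable one_ne_zero
  refine is_const_of_fderiv_eq_zero hdiff (fun y => ?_) x 0
  ext a
  rw [fderiv_mollified_harmonicPart_eq_zero hν h hq hM hQ hP hQeq φ hφ y a t ht]
  rfl

/-- **Tao 2011, Lemma 4.1 (i), for `L^q` slices (pressure normalisation, `2 < q`).** Let `(u, p)`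
be a classical solution of the unforced Navier–Stokes system with viscosity `ν ≥ 0` on `(t₁, t₂)`
(`IsClassicalNSSolutionOn (Ioo t₁ t₂) ν 0 u p`) with `‖u(t)‖_{L^q} ≤ M`, and let
`Q(t) ∈ L^{q/2}`, `‖Q(t)‖_{L^{q/2}} ≤ P`, solve the weak pressure Poisson equation
`∫ Q(t) Δφ = −∫ D²φ(u(t), u(t))` for `t ∈ (t₁, t₂)`. Then for every `t ∈ (t₁, t₂)` there is a
constant `C` with `p(t, x) = Q(t)(x) + C` for a.e. `x`. [cite: Tao2011, Lemma 4.1 (i) and its proof, §4] -/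
theorem pressure_ae_eq_add_const {t₁ t₂ : ℝ} (hν : 0 ≤ ν)
    (h : IsClassicalNSSolutionOn (Ioo t₁ t₂) ν 0 u p) {q : ℝ} (hq : 2 < q) {M : ℝ≥0}
    (hM : ∀ t ∈ Ioo t₁ t₂, eLpNorm (u t) (ENNReal.ofReal q) volume ≤ M)
    (hQ : ∀ t ∈ Ioo t₁ t₂, MemLp (Qt t) (ENNReal.ofReal (q / 2)) volume) {P : ℝ≥0}
    (hP : ∀ t ∈ Ioo t₁ t₂, eLpNorm (Qt t) (ENNReal.ofReal (q / 2)) volume ≤ P)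
    (hQeq : ∀ t ∈ Ioo t₁ t₂, ∀ φ : (EuclideanSpace ℝ (Fin 3)) → ℝ, ContDiff ℝ ∞ φ →
      HasCompactSupport φ → ∫ y, Qt t y * (Δ φ) y = -∫ y, fderiv ℝ (fderiv ℝ φ) y (u t y) (u t y))
    {t : ℝ} (ht : t ∈ Ioo t₁ t₂) :
    ∃ C : ℝ, ∀ᵐ x ∂(volume : Measure (EuclideanSpace ℝ (Fin 3))), p t x = Qt t x + C := by
  have hq21 : (1 : ℝ≥0∞) ≤ ENNReal.ofReal (q / 2) := by
    rw [← ENNReal.ofReal_one]; exact ENNReal.ofReal_le_ofReal (by linarith)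
  obtain ⟨C, hC⟩ := ConvolutionLaplacian.ae_eq_const_of_forall_convolution_normed_const
    (locallyIntegrable_harmonicPart h ht ((hQ t ht).locallyIntegrable hq21))
    (fun φ hφ => ⟨_, fun x => mollified_harmonicPart_eq_const hν h hq hM hQ hP hQeq φ hφ ht x⟩)
  refine ⟨C, hC.mono fun x hx => ?_⟩
  have hx' : p t x - Qt t x = C := hx
  linarith

/-! ### With the Calderón–Zygmund pressure of `exists_rieszPressure` -/

/-- **The pressure of a classical `L^q` solution is the Calderón–Zygmund pressure up to a
function of time** (Chae–Wolf 2017, the normalisation behind (2.4b); Tao 2011, Lemma 4.1 (i)).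
Let `2 < q < ∞` and let `(u, p)` be a classical solution of the unforced system (`ν ≥ 0`) on
`(t₁, t₂)` with `sup_t ‖u(t)‖_{L^q} ≤ M < ∞`. Then there is a constant `C_q` such that for every
`t ∈ (t₁, t₂)` there are `Q ∈ L^{q/2}(ℝ³)` and `C ∈ ℝ` with `‖Q‖_{L^{q/2}} ≤ C_q ‖u(t)‖²_{L^q}`,
`∫ Q Δφ = −∫ D²φ(u(t), u(t))` for all test functions `φ` (i.e. `Q = RᵢRⱼ(uᵢuⱼ)(t)`), and
`p(t, x) = Q(x) + C` for a.e. `x`. [cite: ChaeWolf2017RemovingDSS, §2 (2.4b) (arXiv p. 5); Tao2011 Lemma 4.1 (i)] -/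
theorem exists_pressure_ae_eq_rieszPressure_add_const {t₁ t₂ : ℝ} (hν : 0 ≤ ν)
    (h : IsClassicalNSSolutionOn (Ioo t₁ t₂) ν 0 u p) {q : ℝ} (hq : 2 < q)
    (hLq : ∀ t ∈ Ioo t₁ t₂, MemLp (u t) (ENNReal.ofReal q) volume) {M : ℝ≥0}
    (hM : ∀ t ∈ Ioo t₁ t₂, eLpNorm (u t) (ENNReal.ofReal q) volume ≤ M) :
    ∃ Cq : ℝ≥0, ∀ t ∈ Ioo t₁ t₂, ∃ Q : (EuclideanSpace ℝ (Fin 3)) → ℝ,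
      MemLp Q (ENNReal.ofReal (q / 2)) volume ∧
      eLpNorm Q (ENNReal.ofReal (q / 2)) volume ≤
        Cq * eLpNorm (u t) (ENNReal.ofReal q) volume ^ 2 ∧
      (∀ φ : (EuclideanSpace ℝ (Fin 3)) → ℝ, ContDiff ℝ ∞ φ → HasCompactSupport φ →
        ∫ y, Q y * (Δ φ) y = -∫ y, fderiv ℝ (fderiv ℝ φ) y (u t y) (u t y)) ∧
      ∃ C : ℝ, ∀ᵐ x ∂(volume : Measure (EuclideanSpace ℝ (Fin 3))), p t x = Q x + C := by
  have hq2 : 1 < q / 2 := by linarith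
  obtain ⟨Cq, hCq⟩ := exists_rieszPressure hq2
  have e2 : ENNReal.ofReal (q / 2) * 2 = ENNReal.ofReal q := by
    rw [← ENNReal.ofReal_ofNat 2, ← ENNReal.ofReal_mul (by linarith)]
    congr 1; ring
  -- the slice pressures
  have hex : ∀ t ∈ Ioo t₁ t₂, ∃ Q : (EuclideanSpace ℝ (Fin 3)) → ℝ,
      MemLp Q (ENNReal.ofReal (q / 2)) volume ∧
      eLpNorm Q (ENNReal.ofReal (q / 2)) volume ≤ Cq * eLpNorm (u t) (ENNReal.ofReal q) volume ^ 2 ∧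
      ∀ φ : (EuclideanSpace ℝ (Fin 3)) → ℝ, ContDiff ℝ ∞ φ → HasCompactSupport φ →
        ∫ y, Q y * (Δ φ) y = -∫ y, fderiv ℝ (fderiv ℝ φ) y (u t y) (u t y) := by
    intro t ht
    have hu : MemLp (u t) (ENNReal.ofReal (q / 2) * 2) volume := by rw [e2]; exact hLq t ht
    obtain ⟨Q, hQ, hQb, hQeq⟩ := hCq (u t) hu
    rw [e2] at hQb
    exact ⟨Q, hQ, hQb, hQeq⟩
  choose! Qt hQt hQtb hQteq using hex
  refine ⟨Cq, fun t ht => ⟨Qt t, hQt t ht, hQtb t ht, hQteq t ht, ?_⟩⟩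
  -- uniform bound `‖Q(t)‖ ≤ Cq M²`
  have hP : ∀ s ∈ Ioo t₁ t₂, eLpNorm (Qt s) (ENNReal.ofReal (q / 2)) volume ≤ ((Cq * M ^ 2 : ℝ≥0) : ℝ≥0∞) := by
    intro s hs
    calc eLpNorm (Qt s) (ENNReal.ofReal (q / 2)) volume
        ≤ Cq * eLpNorm (u s) (ENNReal.ofReal q) volume ^ 2 := hQtb s hs
      _ ≤ Cq * (M : ℝ≥0∞) ^ 2 := by gcongr; exact hM s hs
      _ = ((Cq * M ^ 2 : ℝ≥0) : ℝ≥0∞) := by push_cast; ring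
  exact pressure_ae_eq_add_const hν h hq hM hQt hP hQteq ht

end PressureNormalisation

end Literature.Analysis.FluidPDE

end
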